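import Summits.RiemannHypothesis.RiemannHypothesis.Theses.WeilSemilocal
import Summits.RiemannHypothesis.RiemannHypothesis.Theorems.ThetaTier2RowsTwinAll
import Summits.RiemannHypothesis.RiemannHypothesis.Theorems.HandoffWindow
import HarnessLib

/-!
# Route `WeilSemilocal` — the crux `WallsTenKTwin` REDUCED to one row-level UC statement (item stmt-RiemannHypothesis-19172; RH-FREE)

Everything of the tier-2 closer except the analytic bridge: given the row-level upper clause
`UC2 : ∀ r : Row2, T2Valid r.inp r.real → r.RowFacts → r.qn = r.q + 2 → r.m = 5 → a*(S_{r.q}) < (log r.qn)/2`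
(= weil-1's `ThetaTier2Bridge` ∘ `ucT2Cheb_of_valid` ∘ cc-s2-3's `ucT2_of_bounds`, applied to `ofRow2 r`), the route statement
`WallsTenKTwin` follows from the KERNEL side alone: `ThetaTier2.exists_twin_row` (coverage `twin_cover` + the 13 certified data modules +
`Row2.check_sound`), twins are consecutive primes (`consecutivePrimes_twin`: `q + 1` is even), and `log` is monotone (`q + 2 ≤ q'` for every
prime `q' > q`).  The closer proper is then `wallsTenKTwin_proof := wallsTenKTwin_of_uc UC2`.  UPPER clauses of truncated Weil forms only
(LADDER-RH W-P(P2)); nothing here bears on the truth of RH.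
-/

set_option linter.dupNamespace false  -- the mandated namespace repeats `RiemannHypothesis`
set_option autoImplicit false

namespace Summit.RiemannHypothesis.RiemannHypothesis.Theorems.WeilSemilocalRoute

open Summit.RiemannHypothesis.RiemannHypothesis.Theorems Summit.RiemannHypothesis.RiemannHypothesis.Theorems.ThetaTier2
open Summit.RiemannHypothesis.RiemannHypothesis.Theorems.MotivicDoor.SemilocalThreshold

/-- Twin primes are consecutive primes (`q ≥ 3`: `q + 1` is even). [folklore] -/
theorem consecutivePrimes_twin {q : ℕ} (hq : q.Prime) (h2 : (q + 2).Prime) (h3 : 3 ≤ q) :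
    Handoff.ConsecutivePrimes q (q + 2) := by
  refine ⟨hq, h2, by omega, fun p hp hqp => ?_⟩
  by_contra hlt
  have hp1 : p = q + 1 := by omega
  subst hp1
  have hodd : Odd q := hq.odd_of_ne_two (by omega)
  have heven : Even (q + 1) := hodd.add_one
  have := hp.even_iff.1 heven
  omega

/-- A certified twin row has consecutive primes `(q, q+2)`. [this cell] -/
theorem Row2.consecutivePrimes_of_twin (r : Row2) (hF : r.RowFacts) (hq : r.q.Prime) (hqn' : (r.q + 2).Prime)
    (hqn : r.qn = r.q + 2) : Handoff.ConsecutivePrimes r.q r.qn := by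
  rw [hqn]
  have h2 := hF.two_le_q
  have h3 : 3 ≤ r.q := by
    by_contra h
    have : r.q = 2 := by omega
    rw [this] at hqn'
    exact absurd hqn' (by decide)
  exact consecutivePrimes_twin hq hqn' h3

/-- **`WallsTenKTwin` from the row-level upper clause** (the kernel side of the tier-2 closer: coverage + 193 certified rows + `log`
monotone). [this cell; composition over p467288 `exists_twin_row`] -/
theorem wallsTenKTwin_of_uc
    (UC2 : ∀ r : Row2, T2Valid r.inp r.real → r.RowFacts → r.qn = r.q + 2 → r.m = 5 →
      weilSemilocalThreshold (Nat.primesBelow r.q) < Real.log r.qn / 2) :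
    Summit.RiemannHypothesis.RiemannHypothesis.Theses.WeilSemilocal.WallsTenKTwin := by
  unfold Theses.WeilSemilocal.WallsTenKTwin
  intro q hq hlo hhi htwin q' hq' hlt
  obtain ⟨r, -, hrq, hrqn, hrm, hV, hF⟩ := exists_twin_row q hlo hhi hq htwin
  have huc := UC2 r hV hF (by rw [hrq, hrqn]) hrm
  rw [hrq, hrqn] at huc
  have hcons := consecutivePrimes_twin hq htwin (by omega)
  have hle : (((q + 2 : ℕ)) : ℝ) ≤ q' := by exact_mod_cast hcons.2.2.2 q' hq' hlt
  have h0 : (0 : ℝ) < ((q + 2 : ℕ) : ℝ) := by positivity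
  have hlog := Real.log_le_log h0 hle
  linarith

/-- The same with the upper clause stated through `ConsecutivePrimes r.q r.qn` (the bridge's natural hypothesis) and the primality of
`q`, `q + 2`. [this cell] -/
theorem wallsTenKTwin_of_uc'
    (UC2 : ∀ r : Row2, T2Valid r.inp r.real → r.RowFacts → Handoff.ConsecutivePrimes r.q r.qn → r.m = 5 →
      weilSemilocalThreshold (Nat.primesBelow r.q) < Real.log r.qn / 2) :
    Summit.RiemannHypothesis.RiemannHypothesis.Theses.WeilSemilocal.WallsTenKTwin := by
  unfold Theses.WeilSemilocal.WallsTenKTwin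
  intro q hq hlo hhi htwin q' hq' hlt
  obtain ⟨r, -, hrq, hrqn, hrm, hV, hF⟩ := exists_twin_row q hlo hhi hq htwin
  have hcons := consecutivePrimes_twin hq htwin (by omega)
  have hconsr : Handoff.ConsecutivePrimes r.q r.qn := by rw [hrq, hrqn]; exact hcons
  have huc := UC2 r hV hF hconsr hrm
  rw [hrq, hrqn] at huc
  have hle : (((q + 2 : ℕ)) : ℝ) ≤ q' := by exact_mod_cast hcons.2.2.2 q' hq' hlt
  have h0 : (0 : ℝ) < ((q + 2 : ℕ) : ℝ) := by positivity
  have hlog := Real.log_le_log h0 hle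
  linarith

/-- **`WallsTenKTwin` from a row-level upper clause taking the kernel verdict itself**: for a bridge stated as
`∀ r, r.check = true → ConsecutivePrimes r.q r.qn → r.m = 5 → a*(S_{r.q}) < (log r.qn)/2` (everything decidable about the row is then
available to it through `Row2.check_sound` / `Row2.check_signs`). [this cell; composition over `exists_twin_row_check`] -/
theorem wallsTenKTwin_of_check
    (UC2 : ∀ r : Row2, r.check = true → Handoff.ConsecutivePrimes r.q r.qn → r.m = 5 →
      weilSemilocalThreshold (Nat.primesBelow r.q) < Real.log r.qn / 2) :
    Summit.RiemannHypothesis.RiemannHypothesis.Theses.WeilSemilocal.WallsTenKTwin := by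
  unfold Theses.WeilSemilocal.WallsTenKTwin
  intro q hq hlo hhi htwin q' hq' hlt
  obtain ⟨r, -, hrq, hrqn, hrm, hck⟩ := exists_twin_row_check q hlo hhi hq htwin
  have hcons := consecutivePrimes_twin hq htwin (by omega)
  have hconsr : Handoff.ConsecutivePrimes r.q r.qn := by rw [hrq, hrqn]; exact hcons
  have huc := UC2 r hck hconsr hrm
  rw [hrq, hrqn] at huc
  have hle : (((q + 2 : ℕ)) : ℝ) ≤ q' := by exact_mod_cast hcons.2.2.2 q' hq' hlt
  have h0 : (0 : ℝ) < ((q + 2 : ℕ) : ℝ) := by positivity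
  have hlog := Real.log_le_log h0 hle
  linarith

end Summit.RiemannHypothesis.RiemannHypothesis.Theorems.WeilSemilocalRoute
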